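import Summits.ResolutionOfSingularities.ResolutionOfSingularities.Theorems.RadicialJungCleanModelsSufficeGameGerms
import Literature.AlgebraicGeometry.Resolution.PrimeDivisorIdeals

/-!
# Route `RadicialJung`, crux `CleanModelsSuffice`, line `Sketch`: the exceptionalisation game —
# the generisations `η_t` and the local descriptions (C) near a point

Helper for the registered stubs `stub_gameCentre1` / `stub_gameCentre2` of the skeleton of
`Summit.ResolutionOfSingularities.ResolutionOfSingularities.Theses.RadicialJung.CleanModelsSuffice`
(stmt-ResolutionOfSingularities-15883). For a game state `S`, a point `v` and a set `t` of
coordinates at `v`, `S.gen v t` is the generisation `η_t` of `v` defined by the prime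
`(u_{v,i} : i ∈ t)` of `𝒪_{V,v}` (generic point of the coordinate subspace `V(u_t)` near `v`).

* dictionary: `gen_specializes`, `gen_specializes_fromSpecStalk_iff`, `gen_specializes_gen_iff`,
  `not_isRegularLocalRing_gen_iff` ((B) at `η_t`: singular iff `t` contains two charged coordinates);
* **(C)** on a neighbourhood `U` of `v`: `S₂ ∩ U = ⋃_{i<j charged} cl(η_{ij}) ∩ U`
  (`exists_nhds_not_isRegularLocalRing_iff`), `⋂_{i∈t} cl(η_i) ∩ U = cl(η_t) ∩ U`
  (`exists_nhds_gen_specializes_iff`), and for the exceptional divisors `D ∈ E` through `v`: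
  `D ∩ U = cl(η_{lab D}) ∩ U`, while those not through `v` miss `U`
  (`exists_nhds_mem_support_iff`) — all by the germ lemma `Γ` of `GermsOfClosedSubsets.lean`;
The count itself ((E): `|ch w| = #{i ∈ ch v | η_i ⤳ w}` near `v`) is `…GameCountE.lean`.
-/

noncomputable section

set_option linter.dupNamespace false -- mandated namespace of this single-conjunct summit

open CategoryTheory AlgebraicGeometry TopologicalSpace IsLocalRing
open Literature.AlgebraicGeometry.Resolution Literature.AlgebraicGeometry.Motives
open Summit.ResolutionOfSingularities.ResolutionOfSingularities.Theorems.Picover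

namespace Summit.ResolutionOfSingularities.ResolutionOfSingularities.Theorems.RadicialJung.CleanModelsSuffice

attribute [local instance] stalkAlgebra isScalarTower_stalkAlgebra

/-- A scheme locally of finite type over a field is locally Noetherian. [folklore] -/
theorem isLocallyNoetherian_of_hom_field {X : Scheme.{0}} (k : Type) [Field k]
    (f : X ⟶ Spec (.of k)) [LocallyOfFiniteType f] : IsLocallyNoetherian X :=
  haveI : IsLocallyNoetherian (Spec (.of k)) := inferInstance
  LocallyOfFiniteType.isLocallyNoetherian f

namespace GameState

variable {p : ℕ} {V₀ : Scheme.{0}} [IsIntegral V₀] {L : Type} [Field L] [Algebra V₀.functionField L]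
  {V : Scheme.{0}} [IsIntegral V] {π : V ⟶ V₀} [IsDominant π]
  (S : GameState p V₀ L V π)

/-! ## The generisations `η_t` of `v` cut out by sets of coordinates -/

section Gen

variable (v : V)

/-- The coordinates `u_v` form a regular system of parameters (`IsRsopPart`). [folklore] -/
theorem isRsopPart_u : IsRsopPart (S.u v) := by
  haveI := S.isRegular v
  have h := isRsopPart_comp_of_rsop (S.spanFinrank_eq v) (S.u v) (S.span_u v) id
    Function.injective_id
  rwa [Function.comp_id] at h

/-- The ideal `(u_{v,i} : i ∈ t)` of a set of coordinates is prime. [folklore] -/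
theorem isPrime_span_image (t : Finset (Fin (S.d v))) :
    (Ideal.span (S.u v '' (t : Set (Fin (S.d v))))).IsPrime := by
  classical
  haveI := S.isRegular v
  let e := t.equivFin
  have h := ((S.isRsopPart_u v).comp (fun j : Fin t.card => (e.symm j).1)
    (fun j j' hjj' => e.symm.injective (Subtype.ext hjj'))).isPrime_span_range
  have hr : Set.range ((S.u v) ∘ fun j : Fin t.card => (e.symm j).1) = S.u v '' (t : Set _) := by
    ext x
    simp only [Set.mem_range, Function.comp_apply, Set.mem_image, Finset.mem_coe]
    constructor
    · rintro ⟨j, rfl⟩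
      exact ⟨(e.symm j).1, (e.symm j).2, rfl⟩
    · rintro ⟨i, hi, rfl⟩
      exact ⟨e ⟨i, hi⟩, by rw [Equiv.symm_apply_apply]⟩
  rwa [hr] at h

/-- The prime `(u_{v,i} : i ∈ t)` as a point of `Spec 𝒪_{V,v}`. [folklore] -/
def genPrime (t : Finset (Fin (S.d v))) : Spec (V.presheaf.stalk v) :=
  ⟨Ideal.span (S.u v '' (t : Set (Fin (S.d v)))), S.isPrime_span_image v t⟩

/-- **The generisation `η_t` of `v` cut out by the coordinates `u_{v,i}`, `i ∈ t`** (the generic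
point of the coordinate subspace `V(u_t)` near `v`). [folklore] -/
def gen (t : Finset (Fin (S.d v))) : V :=
  V.fromSpecStalk v (S.genPrime v t)

/-- `η_t ⤳ v`. [folklore] -/
theorem gen_specializes (t : Finset (Fin (S.d v))) : S.gen v t ⤳ v :=
  fromSpecStalk_specializes _

/-- Membership in the coordinate primes: `u_i ∈ (u_t) ↔ i ∈ t`. [folklore] -/
theorem u_mem_span_image_iff (t : Finset (Fin (S.d v))) (i : Fin (S.d v)) :
    S.u v i ∈ Ideal.span (S.u v '' (t : Set (Fin (S.d v)))) ↔ i ∈ t := by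
  haveI := S.isRegular v
  constructor
  · intro h
    by_contra hi
    exact (S.isRsopPart_u v).not_mem_span_image (S := (t : Set (Fin (S.d v))))
      (fun h' => hi (Finset.mem_coe.mp h')) h
  · exact fun hi => Ideal.subset_span ⟨i, Finset.mem_coe.mpr hi, rfl⟩

/-- `η_t ⤳ η_𝔮 ↔ u_i ∈ 𝔮` for all `i ∈ t`. [folklore] -/
theorem gen_specializes_fromSpecStalk_iff (t : Finset (Fin (S.d v)))
    (q : PrimeSpectrum (V.presheaf.stalk v)) :
    S.gen v t ⤳ V.fromSpecStalk v q ↔ ∀ i ∈ t, S.u v i ∈ q.asIdeal := by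
  rw [gen, fromSpecStalk_specializes_iff_le]
  change Ideal.span _ ≤ _ ↔ _
  rw [Ideal.span_le, Set.image_subset_iff]
  exact ⟨fun h i hi => h (Finset.mem_coe.mpr hi), fun h i hi => h i (Finset.mem_coe.mp hi)⟩

/-- `η_t ⤳ η_{t'} ↔ t ⊆ t'`. [folklore] -/
theorem gen_specializes_gen_iff (t t' : Finset (Fin (S.d v))) :
    S.gen v t ⤳ S.gen v t' ↔ t ⊆ t' := by
  refine (S.gen_specializes_fromSpecStalk_iff v t (S.genPrime v t')).trans ?_
  change (∀ i ∈ t, S.u v i ∈ Ideal.span (S.u v '' (t' : Set (Fin (S.d v))))) ↔ _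
  simp only [u_mem_span_image_iff]
  rfl

/-- The `η_t` are pairwise distinct and incomparable on sets of the same size. [folklore] -/
theorem eq_of_gen_specializes_of_card_eq {t t' : Finset (Fin (S.d v))} (h : S.gen v t ⤳ S.gen v t')
    (hc : t.card = t'.card) : t = t' :=
  Finset.eq_of_subset_of_card_le ((S.gen_specializes_gen_iff v t t').mp h) hc.ge

end Gen

/-! ## (B) at the generisations `η_t`, and (C): local descriptions near `v` -/

section Local

variable [Algebra V.functionField L]
  (hp : p.Prime) (k : Type) [Field k] [CharP k p] (f : V ⟶ Spec (.of k)) [LocallyOfFiniteType f]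
  (hdegV : Module.finrank V.functionField L = p)
  (hrange : Set.range (algebraMap V.functionField L) = Set.range (algebraMap V₀.functionField L))
  (hcompat : ∀ g : V₀.functionField,
    algebraMap V.functionField L (RatFn.functionFieldMap π g) = algebraMap V₀.functionField L g)

omit [Algebra V.functionField L] in
/-- A two-element set of charged coordinates. [folklore] -/
theorem mem_powersetCard_two_iff {v : V} (t : Finset (Fin (S.d v))) :
    t ∈ (S.ch v).powersetCard 2 ↔ ∃ i j, i ≠ j ∧ S.a v i ≠ 0 ∧ S.a v j ≠ 0 ∧ t = {i, j} := by
  rw [Finset.mem_powersetCard, Finset.card_eq_two]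
  constructor
  · rintro ⟨hsub, i, j, hij, rfl⟩
    refine ⟨i, j, hij, ?_, ?_, rfl⟩
    · simpa [GameState.ch] using hsub (Finset.mem_insert_self i {j})
    · simpa [GameState.ch] using hsub (Finset.mem_insert_of_mem (Finset.mem_singleton_self j))
  · rintro ⟨i, j, hij, hi, hj, rfl⟩
    refine ⟨?_, i, j, hij, rfl⟩
    intro x hx
    rcases Finset.mem_insert.mp hx with rfl | hx
    · simpa [GameState.ch] using hi
    · rw [Finset.mem_singleton.mp hx]; simpa [GameState.ch] using hj

include hp f hdegV hrange hcompat in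
/-- **(B) at `η_𝔮`, in terms of pairs**: for `v` with a charged coordinate, the normalisation is
singular over `η_𝔮` iff `η_t ⤳ η_𝔮` for some two-element set `t` of charged coordinates.
[folklore] -/
theorem not_isRegularLocalRing_fromSpecStalk_iff_exists_pair (v : V) (hch : ∃ i, S.a v i ≠ 0)
    (q : PrimeSpectrum (V.presheaf.stalk v)) :
    ¬ IsRegularLocalRing (integralClosure (V.presheaf.stalk (V.fromSpecStalk v q)) L) ↔
      ∃ t ∈ (S.ch v).powersetCard 2, S.gen v t ⤳ V.fromSpecStalk v q := by
  rw [S.not_isRegularLocalRing_fromSpecStalk_iff hp k f hdegV hrange hcompat v hch q]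
  constructor
  · rintro ⟨i, j, hij, hi, hj, hiq, hjq⟩
    refine ⟨{i, j}, (S.mem_powersetCard_two_iff _).mpr ⟨i, j, hij, hi, hj, rfl⟩, ?_⟩
    rw [gen_specializes_fromSpecStalk_iff]
    intro x hx
    rcases Finset.mem_insert.mp hx with rfl | hx
    · exact hiq
    · rw [Finset.mem_singleton.mp hx]; exact hjq
  · rintro ⟨t, ht, hspec⟩
    obtain ⟨i, j, hij, hi, hj, rfl⟩ := (S.mem_powersetCard_two_iff t).mp ht
    rw [gen_specializes_fromSpecStalk_iff] at hspec
    exact ⟨i, j, hij, hi, hj, hspec i (Finset.mem_insert_self i {j}),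
      hspec j (Finset.mem_insert_of_mem (Finset.mem_singleton_self j))⟩

include hp f hdegV hrange hcompat in
/-- **(B) at `η_t`**: the normalisation is singular over `η_t` iff `t` contains a two-element set
of charged coordinates. [folklore] -/
theorem not_isRegularLocalRing_gen_iff (v : V) (hch : ∃ i, S.a v i ≠ 0) (t : Finset (Fin (S.d v))) :
    ¬ IsRegularLocalRing (integralClosure (V.presheaf.stalk (S.gen v t)) L) ↔
      ∃ t' ∈ (S.ch v).powersetCard 2, t' ⊆ t := by
  refine (S.not_isRegularLocalRing_fromSpecStalk_iff_exists_pair hp k f hdegV hrange hcompat v hch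
    (S.genPrime v t)).trans ?_
  refine exists_congr fun t' => and_congr_right fun _ => ?_
  exact S.gen_specializes_gen_iff v t' t

include hp f hdegV hrange hcompat in
/-- **(C), the singular locus near `v`**: for `v` with a charged coordinate there is an open
`U ∋ v` on which `w ∈ S₂ ↔ η_t ⤳ w` for some two-element set `t` of charged coordinates of `v`
(`S₂ ∩ U` is the union of the closures of the `η_{ij}`). [folklore] -/
theorem exists_nhds_not_isRegularLocalRing_iff (v : V) (hch : ∃ i, S.a v i ≠ 0) :
    ∃ U : V.Opens, v ∈ U ∧ ∀ w ∈ U,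
      (¬ IsRegularLocalRing (integralClosure (V.presheaf.stalk w) L) ↔
        ∃ t ∈ (S.ch v).powersetCard 2, S.gen v t ⤳ w) := by
  classical
  haveI := isLocallyNoetherian_of_hom_field (X := V) k f
  obtain ⟨U, hvU, hU⟩ := exists_nhds_inter_eq_of_forall_fromSpecStalk
    {w : V | ¬ IsRegularLocalRing (integralClosure (V.presheaf.stalk w) L)}
    (S.isClosed_singTwo hp k f hdegV hrange hcompat) v (((S.ch v).powersetCard 2).image (S.genPrime v))
    (fun q => by
      rw [Set.mem_setOf_eq,
        S.not_isRegularLocalRing_fromSpecStalk_iff_exists_pair hp k f hdegV hrange hcompat v hch q]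
      simp only [Finset.mem_image]
      constructor
      · rintro ⟨t, ht, hspec⟩
        exact ⟨S.genPrime v t, ⟨t, ht, rfl⟩, (fromSpecStalk_specializes_iff_le _ _).mp hspec⟩
      · rintro ⟨_, ⟨t, ht, rfl⟩, hle⟩
        exact ⟨t, ht, (fromSpecStalk_specializes_iff_le _ _).mpr hle⟩)
  refine ⟨U, hvU, fun w hw => ?_⟩
  rw [← Set.mem_setOf_eq (p := fun w : V => ¬ IsRegularLocalRing (integralClosure (V.presheaf.stalk w) L)),
    hU w hw]
  simp only [Finset.mem_image]
  constructor
  · rintro ⟨_, ⟨t, ht, rfl⟩, hspec⟩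
    exact ⟨t, ht, hspec⟩
  · rintro ⟨t, ht, hspec⟩
    exact ⟨S.genPrime v t, ⟨t, ht, rfl⟩, hspec⟩

omit [Algebra V.functionField L] in
/-- **(C), intersections of coordinate subspaces near `v`**: there is an open `U ∋ v` on which
`η_t ⤳ w ↔ η_{{i}} ⤳ w` for all `i ∈ t` (`cl(η_t) ∩ U = ⋂_{i∈t} cl(η_i) ∩ U`). [folklore] -/
theorem exists_nhds_gen_specializes_iff (k : Type) [Field k] (f : V ⟶ Spec (.of k))
    [LocallyOfFiniteType f] (v : V) (t : Finset (Fin (S.d v))) :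
    ∃ U : V.Opens, v ∈ U ∧ ∀ w ∈ U, (S.gen v t ⤳ w ↔ ∀ i ∈ t, S.gen v {i} ⤳ w) := by
  haveI := isLocallyNoetherian_of_hom_field (X := V) k f
  -- the closed set `⋂_{i∈t} cl(η_i)`
  let Z : Set V := ⋂ i ∈ t, closure {S.gen v {i}}
  have hZ : IsClosed Z := isClosed_biInter fun _ _ => isClosed_closure
  have hmemZ : ∀ w, w ∈ Z ↔ ∀ i ∈ t, S.gen v {i} ⤳ w := fun w => by
    simp only [Z, Set.mem_iInter, specializes_iff_mem_closure]
  obtain ⟨U, hvU, hU⟩ := exists_nhds_mem_iff_specializes_of_forall_fromSpecStalk hZ v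
    (S.genPrime v t) (fun q => by
      rw [hmemZ]
      change _ ↔ Ideal.span _ ≤ q.asIdeal
      rw [Ideal.span_le, Set.image_subset_iff]
      refine ⟨fun h i hi => ?_, fun h i hi => ?_⟩
      · have := (S.gen_specializes_fromSpecStalk_iff v {i} q).mp (h i (Finset.mem_coe.mp hi))
        exact this i (Finset.mem_singleton_self i)
      · rw [gen_specializes_fromSpecStalk_iff]
        intro j hj
        rw [Finset.mem_singleton.mp hj]
        exact h (Finset.mem_coe.mpr hi))
  exact ⟨U, hvU, fun w hw => ((hU w hw).symm.trans (hmemZ w)).symm.symm⟩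

include S in
omit [Algebra V.functionField L] in
/-- **(C), the exceptional divisors near `v`**: there is an open `U ∋ v` meeting only the members
of `E` through `v`, on which `w ∈ D ↔ η_{lab D} ⤳ w` for every `D ∈ E` through `v`
(`D ∩ U = cl(η_{lab D}) ∩ U`: the germ of `D` at `v` is `(u_{lab D})`, and the stalk of `𝒥_D` at a
generisation is the extended ideal). [folklore] -/
theorem exists_nhds_mem_support_iff (k : Type) [Field k] (f : V ⟶ Spec (.of k))
    [LocallyOfFiniteType f] (v : V) :
    ∃ U : V.Opens, v ∈ U ∧ ∀ w ∈ U,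
      (∀ D ∈ S.E, w ∈ D.support → v ∈ D.support) ∧
      (∀ (D : V.IdealSheafData) (hD : D ∈ S.E ∧ v ∈ D.support),
        w ∈ D.support ↔ S.gen v {S.lab v ⟨D, hD⟩} ⤳ w) := by
  classical
  haveI := isLocallyNoetherian_of_hom_field (X := V) k f
  -- for `D` through `v`: `D ∩ U_D = cl(η_{lab D}) ∩ U_D`
  have hthrough : ∀ (D : V.IdealSheafData) (hD : D ∈ S.E ∧ v ∈ D.support),
      ∃ U : V.Opens, v ∈ U ∧ ∀ w ∈ U, (w ∈ D.support ↔ S.gen v {S.lab v ⟨D, hD⟩} ⤳ w) := by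
    intro D hD
    obtain ⟨U, hvU, hU⟩ := exists_nhds_mem_iff_specializes_of_forall_fromSpecStalk
      D.support.isClosed v (S.genPrime v {S.lab v ⟨D, hD⟩}) (fun q => by
        letI := (V.presheaf.stalkSpecializes (fromSpecStalk_specializes q)).hom.toAlgebra
        haveI := isLocalization_generisation v q
        change V.fromSpecStalk v q ∈ D.support ↔ Ideal.span _ ≤ q.asIdeal
        rw [mem_support_iff_stalkIdeal_le,
          ← stalkIdeal_map_stalkSpecializes D (fromSpecStalk_specializes q), S.stalkIdeal_lab v ⟨D, hD⟩,
          Ideal.map_span, Set.image_singleton, Ideal.span_singleton_le_iff_mem, Finset.coe_singleton,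
          Set.image_singleton, Ideal.span_singleton_le_iff_mem]
        exact IsLocalization.AtPrime.to_map_mem_maximal_iff _ q.asIdeal _)
    exact ⟨U, hvU, fun w hw => hU w hw⟩
  choose Uth hvUth hUth using hthrough
  -- the neighbourhood: avoid the divisors not through `v`
  let W : V.IdealSheafData → V.Opens := fun D =>
    if hD : D ∈ S.E ∧ v ∈ D.support then Uth D hD else ⟨(D.support : Set V)ᶜ, D.support.isClosed.isOpen_compl⟩
  have hvW : ∀ D ∈ S.E, v ∈ W D := by
    intro D hDE
    by_cases hD : D ∈ S.E ∧ v ∈ D.support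
    · simp only [W, dif_pos hD]; exact hvUth D hD
    · simp only [W, dif_neg hD]
      exact fun hv => hD ⟨hDE, hv⟩
  refine ⟨⟨⋂ D ∈ S.E.toFinset, (W D : Set V), isOpen_biInter_finset fun D _ => (W D).isOpen⟩,
    ?_, fun w hw => ⟨fun D hDE hwD => ?_, fun D hD => ?_⟩⟩
  · simp only [Opens.mem_mk, Set.mem_iInter, List.mem_toFinset]
    exact fun D hD => hvW D hD
  · have hw' : w ∈ (W D : Set V) := by
      simp only [Opens.mem_mk, Set.mem_iInter, List.mem_toFinset] at hw
      exact hw D hDE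
    by_contra hvD
    have hD : ¬ (D ∈ S.E ∧ v ∈ D.support) := fun h => hvD h.2
    simp only [W, dif_neg hD] at hw'
    exact hw' hwD
  · have hw' : w ∈ (W D : Set V) := by
      simp only [Opens.mem_mk, Set.mem_iInter, List.mem_toFinset] at hw
      exact hw D hD.1
    simp only [W, dif_pos hD] at hw'
    exact hUth D hD w hw'


end Local

end GameState

end Summit.ResolutionOfSingularities.ResolutionOfSingularities.Theorems.RadicialJung.CleanModelsSuffice

end
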